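import Mathlib
import HarnessLib
import Summits.HubbardSuperconductivity.HubbardSuperconductivity.Theorems.KLProgrammeKLRegimeEngineRelGainAngularMass
import Summits.HubbardSuperconductivity.HubbardSuperconductivity.Theorems.KLProgrammeKLRegimeEngineV8PairTransferRelBarF
import Summits.HubbardSuperconductivity.HubbardSuperconductivity.Theorems.KLProgrammeKLRegimeSplitEdgeFactsRungProfile
import Summits.HubbardSuperconductivity.HubbardSuperconductivity.Theorems.KLProgrammeKLRegimeSplitEdgeFactsIdxLines
import Summits.HubbardSuperconductivity.HubbardSuperconductivity.Theorems.KLProgrammeKLRegimeSplitThermalLayerExt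

/-!
# Route `KLProgramme` — ENGINE child gen 8 (stmt-HubbardSuperconductivity-20437 `KLRegimeEngineV17F2`), skeleton v2 class #5 (Export5/6), located item #19 «(c)-DRESSING-AVG»:
# the relative bar's ROW CONVOLVED WITH A WINDOWED WEIGHT — `klam_transferBarRelAtWF_conv_le` and its instances on p1's (W2-ρ)/(W2-a) rows
# (cell gate-hubbard-kl, seat hubbard-kl-k3c1-p1 g11, technique «composed-map remainder propagation»; glue «TAKEN W2-glue», KL STATUS 2026-08-28T02:17Z)

WHY.  The SIZES bundles of the class-#5 keyed steps (`pairTransferRelAt_succ_keyed` p592121, `pairTransferRelRes_succ_keyed` / `pairTransferRelAt_of_relResidue` p594243) contain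
convolutions `Σ_c Tb(Qm,k,c)·w_c` of a relative-bar row `Tb = transferBarRelAtWF …` (or its index-keyed instance `transferBarRelIdx`) with a label weight `w ≥ 0` — the rung
profiles `ρᵢ` of the dressing and the relative pinned weights `|a|`.  The bar row carries the RELATIVE GAIN profile twice (`klRelGain n |k − c|_𝕋`, `klRelGain n |k + c − Qm|_𝕋`)
plus `c`-independent slots; the layer cake `klam_relGain_angular_le` (p593991) bounds a gain convolution by `(n+2)·(A·Λₙ·(1+2I) + Z/2^I)` from a WINDOWED mass
`Σ_{|c − x|_𝕋 ≤ η} w_c ≤ A·η` (`η ≥ η₀`, `η₀ ≤ Λₙ`) and a total mass `Σ w ≤ Z`; p1's EdgeFacts rows (p594990 `…EdgeFactsWindowedMass`, p595396 `…EdgeFactsRungProfile`) supply exactly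
these with `η₀ = π/L`.  This file is the glue:
* `klam_pi_div_le_klScale` (`π/L ≤ Λₙ` from `klBetaMin ≤ β`, `n ≤ n_β + 1`, `4β ≤ L`); the window of the first gain is centred at `k` (`klvr_klTorusNorm_sub_comm`), of the
  second at `Qm − k`;
* **`klam_transferBarRelAtWF_conv_le`** — for `w ≥ 0` windowed by `(A, η₀)` at EVERY centre and of total mass `≤ Z`, `η₀ ≤ Λₙ`, `0 ≤ r`, `0 ≤ P.Klam`, `0 ≤ G.CF`, `0 ≤ ms`, `0 ≤ ov`:
  `Σ_c transferBarRelAtWF L G P r β U n ms ov Qm k c · w c ≤ r·{(KlamU)²·[(2·Gain + (2^{−n} + 1/L)·Z)·ms + 4^{−n}·ov·Z] + [(Klam|U|)³2^{−n} + thermalBar n]·ms·Z}`,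
  `Gain := (n+2)·(A·Λₙ·(1+2I) + Z/2^I)` (any `I : ℕ`); **`klam_transferBarRelIdx_conv_le`** — the same for the index-keyed bar (`r ↦ klIdxPrefactor r n`, `ms ↦ klIdxMass n m′`,
  `ov ↦ klIdxOverlap n m′`);
* instances: **`klam_transferBarRelIdx_conv_rungProfile_le`** (`w = klRungProfile … n s_{n+1,j} Qm′`: `A = 2·369144/π`, `Z = 738288`) and
  **`klam_transferBarRelIdx_conv_transferWeight_le`** (`w = |tₙ[s_{n,m}](Qm′,·) − tₙ[s_{n,m′}](Qm′,·)|`: `A = (2·61524/π)·4^{−(m′−n)}`, `Z = 4·klIdxMass n m′`).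
* §3 (appended after Export7 p597496): `transferBarRelAtWF_swap`/`transferBarRelIdx_swap` (the bar is symmetric in its momenta), **`klam_transferBarRelIdx_colConv_le`**,
  **`klam_transferBarRelIdx_dblConv_le`** (the column and double FT shapes of `pairLadderStepAtV17F2_of_relFamilyK5`'s `htower`), `klam_window_abs_klTransferWeight_le_linear`
  and **`klam_transferBarRelIdx_conv_absTransferWeight_le`** (single pinned weight: `(A, Z) = ((2·61524/π)·4^{−(m₁−n)}, 2¹⁶)`).
Arithmetic on landed bars and rows; nothing about the model beyond p1's rows is used; nothing asserts any stub, K3 or superconductivity.  0 kit · 0 lit.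
-/

noncomputable section

namespace Summit.HubbardSuperconductivity.HubbardSuperconductivity.Theorems.KLRegimeSplit

set_option linter.dupNamespace false -- summit = problem name (single-conjunct summit), D-0017

open Finset Literature.MathematicalPhysics.QuantumLattice Literature.Probability.LatticeModels
open Summit.HubbardSuperconductivity.HubbardSuperconductivity.Theorems.KLProgrammeLegKernels
open Summit.HubbardSuperconductivity.HubbardSuperconductivity.Theorems.DispersionFlow

/-! ## §0 The mesh floor `π/L ≤ Λₙ` (the torus-norm symmetry is `klvr_klTorusNorm_sub_comm`, `…EngineValueClauseReduction`) -/

section Windows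

variable {L : ℕ} [NeZero L]

omit [NeZero L] in
/-- **The mesh floor is below every scale of the extended ladder**: `π/L ≤ Λₙ` for `klBetaMin ≤ β`, `n ≤ n_β + 1`, `4β ≤ L`. -/
theorem klam_pi_div_le_klScale {β : ℝ} (hβ : klBetaMin ≤ β) {n : ℕ} (hn : n ≤ nScales β + 1) (hL : 4 * β ≤ (L : ℝ)) :
    Real.pi / (L : ℝ) ≤ klScale klE0 n := by
  have hβ0 : 0 < β := pos_of_klBetaMin_le hβ
  have h4 := klte_pi_div_le_four_mul_klScale hβ hn
  have hπ := Real.pi_pos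
  calc Real.pi / (L : ℝ) ≤ Real.pi / (4 * β) := div_le_div_of_nonneg_left hπ.le (by positivity) hL
    _ = Real.pi / β / 4 := by rw [div_div, mul_comm]
    _ ≤ klScale klE0 n := by linarith

end Windows

/-! ## §1 The bar row convolved with a windowed weight -/

section Conv

variable {L : ℕ} [NeZero L]

/-- **One gain convolution, window centred anywhere**: `w ≥ 0` windowed by `(A, η₀)` at the centre `x` and of total mass `≤ Z`, `η₀ ≤ Λₙ` ⇒
`Σ_c klRelGain n |c − x|_𝕋 · w c ≤ (n+2)·(A·Λₙ·(1+2I) + Z/2^I)`. -/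
theorem klam_sum_relGain_mul_le (w : TorusSite 2 L → ℝ) (n I : ℕ) {η₀ A Z : ℝ} (hw : ∀ c, 0 ≤ w c) (hη₀ : η₀ ≤ klScale klE0 n) (x : TorusSite 2 L)
    (hmass : ∀ η : ℝ, η₀ ≤ η → ∑ c ∈ (univ : Finset (TorusSite 2 L)).filter (fun c => klTorusNorm L (c - x) ≤ η), w c ≤ A * η) (hZ : ∑ c, w c ≤ Z) :
    ∑ c, klRelGain n (klTorusNorm L (c - x)) * w c ≤ (n + 2) * (A * klScale klE0 n * (1 + 2 * I) + Z / 2 ^ I) := by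
  have h := klam_relGain_angular_le w (fun c => klTorusNorm L (c - x)) n I hw hη₀ hmass hZ
  simpa only [mul_comm (w _)] using h

/-- **`klam_transferBarRelAtWF_conv_le`** — the relative bar's row `c ↦ transferBarRelAtWF L G P r β U n ms ov Qm k c` convolved with a weight `w ≥ 0` windowed by `(A, η₀)` at
every centre and of total mass `≤ Z` (`η₀ ≤ Λₙ`; `0 ≤ r`, `0 ≤ P.Klam`, `0 ≤ G.CF`, `0 ≤ ms`, `0 ≤ ov`):
`Σ_c Tb(Qm,k,c)·w c ≤ r·{(KlamU)²·[(2·(n+2)·(A·Λₙ·(1+2I) + Z/2^I) + (2^{−n} + 1/L)·Z)·ms + 4^{−n}·ov·Z] + [(Klam|U|)³2^{−n} + thermalBar n]·ms·Z}`. -/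
theorem klam_transferBarRelAtWF_conv_le {G : GeoConsts} (hCF : 0 ≤ G.CF) {P : SplitConsts} (hK : 0 ≤ P.Klam) {r : ℝ} (hr : 0 ≤ r) (β U : ℝ) (n I : ℕ)
    {ms ov : ℝ} (hms : 0 ≤ ms) (hov : 0 ≤ ov) (Qm k : TorusSite 2 L) (w : TorusSite 2 L → ℝ) {η₀ A Z : ℝ} (hw : ∀ c, 0 ≤ w c) (hη₀ : η₀ ≤ klScale klE0 n)
    (hmass : ∀ (x : TorusSite 2 L) (η : ℝ), η₀ ≤ η → ∑ c ∈ (univ : Finset (TorusSite 2 L)).filter (fun c => klTorusNorm L (c - x) ≤ η), w c ≤ A * η)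
    (hZ : ∑ c, w c ≤ Z) :
    ∑ c, transferBarRelAtWF L G P r β U n ms ov Qm k c * w c ≤
      r * ((P.Klam * U) ^ 2 * ((2 * ((n + 2) * (A * klScale klE0 n * (1 + 2 * I) + Z / 2 ^ I)) + (((2 : ℝ) ^ n)⁻¹ + ((L : ℝ))⁻¹) * Z) * ms + ((4 : ℝ) ^ n)⁻¹ * ov * Z) +
        ((P.Klam * |U|) ^ 3 * ((2 : ℝ) ^ n)⁻¹ + thermalBar G P U β n) * ms * Z) := by
  -- split the row into the two gain profiles and the `c`-independent slots
  set K2 : ℝ := (P.Klam * U) ^ 2 with hK2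
  set T : ℝ := (P.Klam * |U|) ^ 3 * ((2 : ℝ) ^ n)⁻¹ + thermalBar G P U β n with hT
  set cst : ℝ := ((2 : ℝ) ^ n)⁻¹ + ((L : ℝ))⁻¹ with hcst
  have hrow : ∀ c, transferBarRelAtWF L G P r β U n ms ov Qm k c * w c =
      r * (K2 * ms) * (klRelGain n (klTorusNorm L (c - k)) * w c) + r * (K2 * ms) * (klRelGain n (klTorusNorm L (c - (Qm - k))) * w c) +
        r * (K2 * (cst * ms + ((4 : ℝ) ^ n)⁻¹ * ov) + T * ms) * w c := by
    intro c
    rw [transferBarRelAtWF_eq, klvr_klTorusNorm_sub_comm k c, show k + c - Qm = c - (Qm - k) by abel]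
    ring
  simp only [hrow, Finset.sum_add_distrib, ← Finset.mul_sum]
  -- the two gain convolutions
  have hg₁ := klam_sum_relGain_mul_le w n I hw hη₀ k (hmass k) hZ
  have hg₂ := klam_sum_relGain_mul_le w n I hw hη₀ (Qm - k) (hmass (Qm - k)) hZ
  have hK2nn : 0 ≤ K2 := by rw [hK2]; positivity
  have hTnn : 0 ≤ T := by
    rw [hT]; have := thermalBar_nonneg' hCF P U β n; positivity
  have hcstnn : 0 ≤ cst := by rw [hcst]; positivity
  have hc₁ : 0 ≤ r * (K2 * ms) := by positivity
  have hc₃ : 0 ≤ r * (K2 * (cst * ms + ((4 : ℝ) ^ n)⁻¹ * ov) + T * ms) := by positivity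
  have h1 := mul_le_mul_of_nonneg_left hg₁ hc₁
  have h2 := mul_le_mul_of_nonneg_left hg₂ hc₁
  have h3 := mul_le_mul_of_nonneg_left hZ hc₃
  calc r * (K2 * ms) * ∑ c, klRelGain n (klTorusNorm L (c - k)) * w c + r * (K2 * ms) * ∑ c, klRelGain n (klTorusNorm L (c - (Qm - k))) * w c +
        r * (K2 * (cst * ms + ((4 : ℝ) ^ n)⁻¹ * ov) + T * ms) * ∑ c, w c
      ≤ r * (K2 * ms) * ((n + 2) * (A * klScale klE0 n * (1 + 2 * I) + Z / 2 ^ I)) + r * (K2 * ms) * ((n + 2) * (A * klScale klE0 n * (1 + 2 * I) + Z / 2 ^ I)) + r * (K2 * (cst * ms + ((4 : ℝ) ^ n)⁻¹ * ov) + T * ms) * Z :=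
        add_le_add (add_le_add h1 h2) h3
    _ = r * (K2 * ((2 * ((n + 2) * (A * klScale klE0 n * (1 + 2 * I) + Z / 2 ^ I)) + cst * Z) * ms + ((4 : ℝ) ^ n)⁻¹ * ov * Z) + T * ms * Z) := by ring

/-- **`klam_transferBarRelIdx_conv_le`** — the index-keyed bar's row convolved with a windowed weight:
`Σ_c transferBarRelIdx L G P r β U n m′ Qm k c · w c ≤ klIdxPrefactor r n·{(KlamU)²·[(2·(n+2)·(A·Λₙ·(1+2I) + Z/2^I) + (2^{−n} + 1/L)·Z)·klIdxMass n m′ + 4^{−n}·klIdxOverlap n m′·Z] +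
[(Klam|U|)³2^{−n} + thermalBar n]·klIdxMass n m′·Z}`. -/
theorem klam_transferBarRelIdx_conv_le {G : GeoConsts} (hCF : 0 ≤ G.CF) {P : SplitConsts} (hK : 0 ≤ P.Klam) {r : ℝ} (hr : 0 ≤ r) (β U : ℝ) (n m' I : ℕ)
    (Qm k : TorusSite 2 L) (w : TorusSite 2 L → ℝ) {η₀ A Z : ℝ} (hw : ∀ c, 0 ≤ w c) (hη₀ : η₀ ≤ klScale klE0 n)
    (hmass : ∀ (x : TorusSite 2 L) (η : ℝ), η₀ ≤ η → ∑ c ∈ (univ : Finset (TorusSite 2 L)).filter (fun c => klTorusNorm L (c - x) ≤ η), w c ≤ A * η)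
    (hZ : ∑ c, w c ≤ Z) :
    ∑ c, transferBarRelIdx L G P r β U n m' Qm k c * w c ≤
      klIdxPrefactor r n * ((P.Klam * U) ^ 2 * ((2 * ((n + 2) * (A * klScale klE0 n * (1 + 2 * I) + Z / 2 ^ I)) + (((2 : ℝ) ^ n)⁻¹ + ((L : ℝ))⁻¹) * Z) * klIdxMass n m' +
          ((4 : ℝ) ^ n)⁻¹ * klIdxOverlap n m' * Z) +
        ((P.Klam * |U|) ^ 3 * ((2 : ℝ) ^ n)⁻¹ + thermalBar G P U β n) * klIdxMass n m' * Z) := by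
  simp only [transferBarRelIdx_eq]
  exact klam_transferBarRelAtWF_conv_le hCF hK (klIdxPrefactor_nonneg hr n) β U n I (klIdxMass_nonneg n m') (klIdxOverlap_nonneg n m') Qm k w hw hη₀ hmass hZ

end Conv

/-! ## §2 Instances on p1's (W2-ρ) / (W2-a) rows (`η₀ = π/L`) -/

section Instances

variable {L M : ℕ} [NeZero L] (β μ : ℝ) (K : TrigPolyC4v) {R : RenConsts} {U : ℝ} {N : ℕ}

/-- **The index bar's row against the RUNG PROFILE of the dressing** (`w = klRungProfile … n s_{n+1,j} Qm′`, (W2-ρ) p595396: `A = 2·369144/π`, `Z = 738288`; admissible frame,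
`klBetaMin ≤ β ≤ L`, `n + 1 ≤ j`, `π/L ≤ Λₙ`):
`Σ_c transferBarRelIdx … n m′ Qm k c · klRungProfile … n s_{n+1,j} Qm′ c ≤ klIdxPrefactor r n·{…}` at `(A, Z) = (2·369144/π, 738288)`. -/
theorem klam_transferBarRelIdx_conv_rungProfile_le (hKf : FrameOK R U N μ K) (hβ : klBetaMin ≤ β) (hβL : β ≤ L) {G : GeoConsts} (hCF : 0 ≤ G.CF)
    {P : SplitConsts} (hK : 0 ≤ P.Klam) {r : ℝ} (hr : 0 ≤ r) (n m' I : ℕ) {j : ℕ} (hj : n + 1 ≤ j) (hη₀ : Real.pi / (L : ℝ) ≤ klScale klE0 n)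
    (Qm Qm' k : TorusSite 2 L) :
    ∑ c, transferBarRelIdx L G P r β U n m' Qm k c * klRungProfile L M β μ K n (softSymbolCompl L M β μ K (n + 1) j) Qm' c ≤
      klIdxPrefactor r n * ((P.Klam * U) ^ 2 * ((2 * ((n + 2) * (2 * 369144 / Real.pi * klScale klE0 n * (1 + 2 * I) + 738288 / 2 ^ I)) + (((2 : ℝ) ^ n)⁻¹ + ((L : ℝ))⁻¹) * 738288) * klIdxMass n m' +
          ((4 : ℝ) ^ n)⁻¹ * klIdxOverlap n m' * 738288) +
        ((P.Klam * |U|) ^ 3 * ((2 : ℝ) ^ n)⁻¹ + thermalBar G P U β n) * klIdxMass n m' * 738288) :=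
  klam_transferBarRelIdx_conv_le hCF hK hr β U n m' I Qm k _ (fun c => klRungProfile_nonneg β μ K (pos_of_klBetaMin_le hβ) n _ Qm' c) hη₀
    (fun x _ hη => sum_window_klRungProfile_compl_le_linear β μ K hKf hβ hβL hj Qm' x hη) (sum_klRungProfile_compl_le β μ K hKf hβ hβL hj Qm')

/-- **The index bar's row against the RELATIVE PINNED WEIGHT** (`w = |tₙ[s_{n,m}](Qm′,·) − tₙ[s_{n,m₁}](Qm′,·)|`, (W2-a) p594990 / `…EdgeFactsIdxLines`:
`A = (2·61524/π)·4^{−(m₁−n)}`, `Z = 4·klIdxMass n m₁`; admissible frame, `klBetaMin ≤ β ≤ L`, `n ≤ m₁ ≤ m`, `π/L ≤ Λₙ`). -/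
theorem klam_transferBarRelIdx_conv_transferWeight_le (hKf : FrameOK R U N μ K) (hβ : klBetaMin ≤ β) (hβL : β ≤ L) {G : GeoConsts} (hCF : 0 ≤ G.CF)
    {P : SplitConsts} (hK : 0 ≤ P.Klam) {r : ℝ} (hr : 0 ≤ r) (n m' I : ℕ) {m m₁ : ℕ} (hn : n ≤ m₁) (h : m₁ ≤ m)
    (hη₀ : Real.pi / (L : ℝ) ≤ klScale klE0 n) (Qm Qm' k : TorusSite 2 L) :
    ∑ c, transferBarRelIdx L G P r β U n m' Qm k c *
        |klTransferWeight L M β μ K n (softSymbolCompl L M β μ K n m) Qm' c - klTransferWeight L M β μ K n (softSymbolCompl L M β μ K n m₁) Qm' c| ≤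
      klIdxPrefactor r n * ((P.Klam * U) ^ 2 *
          ((2 * ((n + 2) * (2 * 61524 / Real.pi * ((4 : ℝ) ^ (m₁ - n))⁻¹ * klScale klE0 n * (1 + 2 * I) + 4 * klIdxMass n m₁ / 2 ^ I)) + (((2 : ℝ) ^ n)⁻¹ + ((L : ℝ))⁻¹) * (4 * klIdxMass n m₁)) *
              klIdxMass n m' + ((4 : ℝ) ^ n)⁻¹ * klIdxOverlap n m' * (4 * klIdxMass n m₁)) +
        ((P.Klam * |U|) ^ 3 * ((2 : ℝ) ^ n)⁻¹ + thermalBar G P U β n) * klIdxMass n m' * (4 * klIdxMass n m₁)) :=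
  klam_transferBarRelIdx_conv_le hCF hK hr β U n m' I Qm k _ (fun _ => abs_nonneg _) hη₀
    (fun x _ hη => sum_window_abs_klTransferWeight_compl_sub_le_linear β μ K hKf hβ hβL hn h Qm' x hη)
    (sum_abs_klTransferWeight_compl_sub_le β μ K hKf hβ hβL hn h Qm')

end Instances

/-! ## §3 (appended, k3c1-p1 g11 after Export7 p597496) COLUMN and DOUBLE convolutions — the three FT shapes of `pairLadderStepAtV17F2_of_relFamilyK5(_klCT7)`'s `htower`
(`Σ_t Tb(Qm,x,t)·|w t|`, `Σ_a |w a|·Tb(Qm,a,y)`, `Σ_a Σ_t |w a|·Tb(Qm,a,t)·|w t|`); the single pinned weight's window -/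

section FT

variable {L : ℕ} [NeZero L]

/-- The relative bar is SYMMETRIC in its two momenta (it reads them through `|k − k′|_𝕋` and `|k + k′ − Qm|_𝕋` only). -/
theorem transferBarRelAtWF_swap (G : GeoConsts) (P : SplitConsts) (r β U : ℝ) (n : ℕ) (ms ov : ℝ) (Qm k k' : TorusSite 2 L) :
    transferBarRelAtWF L G P r β U n ms ov Qm k k' = transferBarRelAtWF L G P r β U n ms ov Qm k' k := by
  rw [transferBarRelAtWF_eq, transferBarRelAtWF_eq, klvr_klTorusNorm_sub_comm k k', add_comm k k']

/-- The index-keyed bar is symmetric in its two momenta. -/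
theorem transferBarRelIdx_swap (G : GeoConsts) (P : SplitConsts) (r β U : ℝ) (n m' : ℕ) (Qm k k' : TorusSite 2 L) :
    transferBarRelIdx L G P r β U n m' Qm k k' = transferBarRelIdx L G P r β U n m' Qm k' k := by
  rw [transferBarRelIdx_eq, transferBarRelIdx_eq, transferBarRelAtWF_swap]

/-- **COLUMN convolution** `Σ_a w a·Tb(Qm,a,y)` of the index-keyed bar with a windowed weight: the same bound as the row (`transferBarRelIdx_swap`). -/
theorem klam_transferBarRelIdx_colConv_le {G : GeoConsts} (hCF : 0 ≤ G.CF) {P : SplitConsts} (hK : 0 ≤ P.Klam) {r : ℝ} (hr : 0 ≤ r) (β U : ℝ) (n m' I : ℕ)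
    (Qm y : TorusSite 2 L) (w : TorusSite 2 L → ℝ) {η₀ A Z : ℝ} (hw : ∀ c, 0 ≤ w c) (hη₀ : η₀ ≤ klScale klE0 n)
    (hmass : ∀ (x : TorusSite 2 L) (η : ℝ), η₀ ≤ η → ∑ c ∈ (univ : Finset (TorusSite 2 L)).filter (fun c => klTorusNorm L (c - x) ≤ η), w c ≤ A * η)
    (hZ : ∑ c, w c ≤ Z) :
    ∑ a, w a * transferBarRelIdx L G P r β U n m' Qm a y ≤
      klIdxPrefactor r n * ((P.Klam * U) ^ 2 * ((2 * ((n + 2) * (A * klScale klE0 n * (1 + 2 * I) + Z / 2 ^ I)) + (((2 : ℝ) ^ n)⁻¹ + ((L : ℝ))⁻¹) * Z) * klIdxMass n m' +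
          ((4 : ℝ) ^ n)⁻¹ * klIdxOverlap n m' * Z) +
        ((P.Klam * |U|) ^ 3 * ((2 : ℝ) ^ n)⁻¹ + thermalBar G P U β n) * klIdxMass n m' * Z) := by
  have h := klam_transferBarRelIdx_conv_le hCF hK hr β U n m' I Qm y w hw hη₀ hmass hZ
  calc ∑ a, w a * transferBarRelIdx L G P r β U n m' Qm a y = ∑ a, transferBarRelIdx L G P r β U n m' Qm y a * w a :=
        Finset.sum_congr rfl fun a _ => by rw [transferBarRelIdx_swap, mul_comm]
    _ ≤ _ := h

/-- **DOUBLE convolution** `Σ_a Σ_t w a·Tb(Qm,a,t)·w t ≤ Z·(row bound)`. -/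
theorem klam_transferBarRelIdx_dblConv_le {G : GeoConsts} (hCF : 0 ≤ G.CF) {P : SplitConsts} (hK : 0 ≤ P.Klam) {r : ℝ} (hr : 0 ≤ r) (β U : ℝ) (n m' I : ℕ)
    (Qm : TorusSite 2 L) (w : TorusSite 2 L → ℝ) {η₀ A Z : ℝ} (hw : ∀ c, 0 ≤ w c) (hη₀ : η₀ ≤ klScale klE0 n)
    (hmass : ∀ (x : TorusSite 2 L) (η : ℝ), η₀ ≤ η → ∑ c ∈ (univ : Finset (TorusSite 2 L)).filter (fun c => klTorusNorm L (c - x) ≤ η), w c ≤ A * η)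
    (hZ : ∑ c, w c ≤ Z) :
    ∑ a, ∑ t, w a * transferBarRelIdx L G P r β U n m' Qm a t * w t ≤
      Z * (klIdxPrefactor r n * ((P.Klam * U) ^ 2 * ((2 * ((n + 2) * (A * klScale klE0 n * (1 + 2 * I) + Z / 2 ^ I)) + (((2 : ℝ) ^ n)⁻¹ + ((L : ℝ))⁻¹) * Z) * klIdxMass n m' +
          ((4 : ℝ) ^ n)⁻¹ * klIdxOverlap n m' * Z) +
        ((P.Klam * |U|) ^ 3 * ((2 : ℝ) ^ n)⁻¹ + thermalBar G P U β n) * klIdxMass n m' * Z)) := by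
  have hrow : ∀ a, ∑ t, transferBarRelIdx L G P r β U n m' Qm a t * w t ≤
      klIdxPrefactor r n * ((P.Klam * U) ^ 2 * ((2 * ((n + 2) * (A * klScale klE0 n * (1 + 2 * I) + Z / 2 ^ I)) + (((2 : ℝ) ^ n)⁻¹ + ((L : ℝ))⁻¹) * Z) * klIdxMass n m' +
          ((4 : ℝ) ^ n)⁻¹ * klIdxOverlap n m' * Z) +
        ((P.Klam * |U|) ^ 3 * ((2 : ℝ) ^ n)⁻¹ + thermalBar G P U β n) * klIdxMass n m' * Z) := fun a =>
    klam_transferBarRelIdx_conv_le hCF hK hr β U n m' I Qm a w hw hη₀ hmass hZ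
  have hB : 0 ≤ klIdxPrefactor r n * ((P.Klam * U) ^ 2 * ((2 * ((n + 2) * (A * klScale klE0 n * (1 + 2 * I) + Z / 2 ^ I)) + (((2 : ℝ) ^ n)⁻¹ + ((L : ℝ))⁻¹) * Z) * klIdxMass n m' +
          ((4 : ℝ) ^ n)⁻¹ * klIdxOverlap n m' * Z) +
        ((P.Klam * |U|) ^ 3 * ((2 : ℝ) ^ n)⁻¹ + thermalBar G P U β n) * klIdxMass n m' * Z) :=
    (Finset.sum_nonneg fun t _ => mul_nonneg (transferBarRelIdx_nonneg hCF hK hr β U n m' Qm 0 t) (hw t)).trans (hrow 0)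
  calc ∑ a, ∑ t, w a * transferBarRelIdx L G P r β U n m' Qm a t * w t = ∑ a, w a * ∑ t, transferBarRelIdx L G P r β U n m' Qm a t * w t := by
        refine Finset.sum_congr rfl fun a _ => ?_
        rw [Finset.mul_sum]
        exact Finset.sum_congr rfl fun t _ => by ring
    _ ≤ ∑ a, w a * (klIdxPrefactor r n * ((P.Klam * U) ^ 2 * ((2 * ((n + 2) * (A * klScale klE0 n * (1 + 2 * I) + Z / 2 ^ I)) + (((2 : ℝ) ^ n)⁻¹ + ((L : ℝ))⁻¹) * Z) * klIdxMass n m' +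
          ((4 : ℝ) ^ n)⁻¹ * klIdxOverlap n m' * Z) +
        ((P.Klam * |U|) ^ 3 * ((2 : ℝ) ^ n)⁻¹ + thermalBar G P U β n) * klIdxMass n m' * Z)) := Finset.sum_le_sum fun a _ => mul_le_mul_of_nonneg_left (hrow a) (hw a)
    _ = (∑ a, w a) * (klIdxPrefactor r n * ((P.Klam * U) ^ 2 * ((2 * ((n + 2) * (A * klScale klE0 n * (1 + 2 * I) + Z / 2 ^ I)) + (((2 : ℝ) ^ n)⁻¹ + ((L : ℝ))⁻¹) * Z) * klIdxMass n m' +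
          ((4 : ℝ) ^ n)⁻¹ * klIdxOverlap n m' * Z) +
        ((P.Klam * |U|) ^ 3 * ((2 : ℝ) ^ n)⁻¹ + thermalBar G P U β n) * klIdxMass n m' * Z)) := by rw [Finset.sum_mul]
    _ ≤ Z * (klIdxPrefactor r n * ((P.Klam * U) ^ 2 * ((2 * ((n + 2) * (A * klScale klE0 n * (1 + 2 * I) + Z / 2 ^ I)) + (((2 : ℝ) ^ n)⁻¹ + ((L : ℝ))⁻¹) * Z) * klIdxMass n m' +
          ((4 : ℝ) ^ n)⁻¹ * klIdxOverlap n m' * Z) +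
        ((P.Klam * |U|) ^ 3 * ((2 : ℝ) ^ n)⁻¹ + thermalBar G P U β n) * klIdxMass n m' * Z)) := mul_le_mul_of_nonneg_right hZ hB

end FT

section FTInstances

variable {L M : ℕ} [NeZero L] (β μ : ℝ) (K : TrigPolyC4v) {R : RenConsts} {U : ℝ} {N : ℕ}

/-- **The single pinned weight's LINEAR window** ((W2-a) p594990 in the layer cake's shape): `0 ≤ D ≤ 1 − w^K_{Λ_m}`, `n ≤ m`, `π/L ≤ η` ⇒
`Σ_{|p − x|_𝕋 ≤ η} |tₙ^K[D](Qm,p)| ≤ (2·61524/π)·4^{−(m−n)}·η`. -/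
theorem klam_window_abs_klTransferWeight_le_linear (hKf : FrameOK R U N μ K) (hβ : klBetaMin ≤ β) (hβL : β ≤ L) {n m : ℕ} (hnm : n ≤ m)
    {D : FreqMomentum L M → ℝ} (hD : ∀ k, 0 ≤ D k ∧ D k ≤ 1 - hubbardCutoffWeightCT L M β μ K (klScale klE0 m) k) (Qm x : TorusSite 2 L)
    {η : ℝ} (hη : Real.pi / L ≤ η) :
    ∑ p ∈ (univ : Finset (TorusSite 2 L)).filter (fun p => klTorusNorm L (p - x) ≤ η), |klTransferWeight L M β μ K n D Qm p| ≤
      2 * 61524 / Real.pi * ((4 : ℝ) ^ (m - n))⁻¹ * η := by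
  have hL : (0 : ℝ) < L := Nat.cast_pos.2 (Nat.pos_of_ne_zero (NeZero.ne L))
  have hπ := Real.pi_pos
  have hη0 : 0 ≤ η := (div_nonneg hπ.le hL.le).trans hη
  have h := sum_window_abs_klTransferWeight_le β μ K hKf hβ hβL hnm hD Qm x hη0
  have hinv : ((L : ℝ))⁻¹ ≤ η / Real.pi := by
    rw [inv_eq_one_div, div_le_div_iff₀ hL hπ, one_mul]
    calc Real.pi = Real.pi / L * L := by field_simp
      _ ≤ η * L := mul_le_mul_of_nonneg_right hη hL.le
  have h4 : 0 ≤ ((4 : ℝ) ^ (m - n))⁻¹ := by positivity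
  calc _ ≤ 61524 * (η / Real.pi + ((L : ℝ))⁻¹) * ((4 : ℝ) ^ (m - n))⁻¹ := h
    _ ≤ 61524 * (η / Real.pi + η / Real.pi) * ((4 : ℝ) ^ (m - n))⁻¹ := by gcongr
    _ = 2 * 61524 / Real.pi * ((4 : ℝ) ^ (m - n))⁻¹ * η := by ring

/-- **The index bar's ROW against the single pinned weight** `w = |tₙ^K[D](Qm′,·)|` (`0 ≤ D ≤ 1 − w^K_{Λ_{m₁}}`, `n ≤ m₁`; `(A, Z) = ((2·61524/π)·4^{−(m₁−n)}, 2¹⁶)`,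
`sum_abs_klTransferWeight_le_of_frameOK` for the total at `m₁ = n`-admissibility): the FT row of `pairLadderStepAtV17F2_of_relFamilyK5`'s `htower`; the column and double
shapes follow from `klam_transferBarRelIdx_colConv_le` / `klam_transferBarRelIdx_dblConv_le` with the same `(A, Z)`. -/
theorem klam_transferBarRelIdx_conv_absTransferWeight_le (hKf : FrameOK R U N μ K) (hβ : klBetaMin ≤ β) (hβL : β ≤ L) {G : GeoConsts} (hCF : 0 ≤ G.CF)
    {P : SplitConsts} (hK : 0 ≤ P.Klam) {r : ℝ} (hr : 0 ≤ r) (n m' I : ℕ) {m₁ : ℕ} (hnm : n ≤ m₁)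
    {D : FreqMomentum L M → ℝ} (hD : ∀ k, 0 ≤ D k ∧ D k ≤ 1 - hubbardCutoffWeightCT L M β μ K (klScale klE0 m₁) k)
    (hDn : ∀ k, 0 ≤ D k ∧ D k ≤ 1 - hubbardCutoffWeightCT L M β μ K (klScale klE0 n) k)
    (hη₀ : Real.pi / (L : ℝ) ≤ klScale klE0 n) (Qm Qm' k : TorusSite 2 L) :
    ∑ c, transferBarRelIdx L G P r β U n m' Qm k c * |klTransferWeight L M β μ K n D Qm' c| ≤
      klIdxPrefactor r n * ((P.Klam * U) ^ 2 *
          ((2 * ((n + 2) * (2 * 61524 / Real.pi * ((4 : ℝ) ^ (m₁ - n))⁻¹ * klScale klE0 n * (1 + 2 * I) + 2 ^ 16 / 2 ^ I)) +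
              (((2 : ℝ) ^ n)⁻¹ + ((L : ℝ))⁻¹) * 2 ^ 16) * klIdxMass n m' + ((4 : ℝ) ^ n)⁻¹ * klIdxOverlap n m' * 2 ^ 16) +
        ((P.Klam * |U|) ^ 3 * ((2 : ℝ) ^ n)⁻¹ + thermalBar G P U β n) * klIdxMass n m' * 2 ^ 16) :=
  klam_transferBarRelIdx_conv_le hCF hK hr β U n m' I Qm k _ (fun _ => abs_nonneg _) hη₀
    (fun x _ hη => klam_window_abs_klTransferWeight_le_linear β μ K hKf hβ hβL hnm hD Qm' x hη)
    (sum_abs_klTransferWeight_le_of_frameOK hKf hβ hβL n hDn Qm')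

end FTInstances

end Summit.HubbardSuperconductivity.HubbardSuperconductivity.Theorems.KLRegimeSplit

end
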